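import Literature.NumberTheory.Sieve.LinearEquationsInPrimesSingularSeries
import HarnessLib

/-!
# Fibration lemma (`DimOne → GeneralizedHardyLittlewood`), part 2: local factors of `d = 1` systems

Support file for the statement item `FibrationLemma : DimOne → GeneralizedHardyLittlewood`
(Green–Tao 2010, §1, remark after Conj. 1.2). For a one-dimensional system
`Φ = (a₁ n + b₁, …, a_t n + b_t)` and a prime `p` not dividing any `aᵢ`, the local factor (1.6) is
completely explicit: each form vanishes mod `p` exactly on the residue `rᵢ = -bᵢ/aᵢ` (`root`), so with
`ν = #{r₁, …, r_t}` (`rootCount`)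

  `β_p(Φ) = (p/(p-1))^t · (p - ν)/p`                                    (`localFactor_dimOne`)

and `rᵢ = rⱼ` iff `p ∣ Dᵢⱼ = aᵢ bⱼ - aⱼ bᵢ` (`root_eq_root_iff`). Consequences recorded here (all
elementary; this is the `d = 1` case of the computation in the proof of Green–Tao's Lemma 1.3):

* `one_le_rootCount`, `rootCount_le` — `1 ≤ ν ≤ t`;
* `localFactor_dimOne_pos`, `localFactor_dimOne_le_pow_pred`, `localFactor_dimOne_ge` —
  `(p/(p-1))^t (p-t)/p ≤ β_p ≤ (p/(p-1))^{t-1}`, `β_p > 0` (`p > t`);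
* `localFactor_dimOne_le_one` — if all roots are distinct (`p ∤ Dᵢⱼ` for `i ≠ j`) then `β_p ≤ 1`;
* `localFactor_dimOne_mono` — **monotonicity in the coincidence pattern**: if every coincidence
  `p ∣ Dᵢⱼ(Φ)` is also a coincidence of `Φ'`, then `β_p(Φ) ≤ β_p(Φ')`.
-/

noncomputable section

open Finset

namespace Summit.Parity.GeneralizedHardyLittlewood.Theorems

open Literature.NumberTheory.Sieve

variable {t : ℕ}

/-! ### Roots and discriminants -/

/-- The root `rᵢ = -bᵢ aᵢ⁻¹ ∈ ℤ/pℤ` of the `i`-th form `aᵢ n + bᵢ` of a `d = 1` system.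
[cite: GreenTao2010, proof of Lemma 1.3] -/
def root (Φ : Fin t → AffLinForm 1) (p : ℕ) (i : Fin t) : ZMod p :=
  -(((Φ i).const : ZMod p) * (((Φ i).coeff 0 : ℤ) : ZMod p)⁻¹)

/-- The number `ν` of distinct roots mod `p`. [cite: GreenTao2010, proof of Lemma 1.3] -/
def rootCount (Φ : Fin t → AffLinForm 1) (p : ℕ) : ℕ :=
  #((univ : Finset (Fin t)).image (root Φ p))

/-- The pair discriminant `Dᵢⱼ = aᵢ bⱼ - aⱼ bᵢ` of two forms of a `d = 1` system (the forms
`i, j` are proportional iff `Dᵢⱼ = 0`, and have the same root mod `p` iff `p ∣ Dᵢⱼ`).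
[cite: GreenTao2010, proof of Lemma 1.3] -/
def disc (Φ : Fin t → AffLinForm 1) (i j : Fin t) : ℤ :=
  (Φ i).coeff 0 * (Φ j).const - (Φ j).coeff 0 * (Φ i).const

/-- `Dᵢᵢ = 0`. [folklore] -/
@[simp] theorem disc_self (Φ : Fin t → AffLinForm 1) (i : Fin t) : disc Φ i i = 0 := by
  simp [disc, mul_comm]

/-- Reduction mod `p` of a `d = 1` form: `φᵢ(v) = aᵢ v₀ + bᵢ`. [folklore] -/
theorem modEval_dimOne (Φ : Fin t → AffLinForm 1) (p : ℕ) (i : Fin t) (v : Fin 1 → ZMod p) :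
    (Φ i).modEval p v = (((Φ i).coeff 0 : ℤ) : ZMod p) * v 0 + ((Φ i).const : ZMod p) := by
  simp [AffLinForm.modEval]

section Prime

variable {p : ℕ} [hp : Fact p.Prime]

/-- If `p ∤ aᵢ` then `φᵢ(v) ≡ 0 (mod p)` iff `v₀` is the root `rᵢ`. [cite: GreenTao2010, proof of Lemma 1.3] -/
theorem modEval_eq_zero_iff (Φ : Fin t → AffLinForm 1) {i : Fin t}
    (ha : (((Φ i).coeff 0 : ℤ) : ZMod p) ≠ 0) (v : Fin 1 → ZMod p) :
    (Φ i).modEval p v = 0 ↔ v 0 = root Φ p i := by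
  rw [modEval_dimOne, root]
  set a : ZMod p := (((Φ i).coeff 0 : ℤ) : ZMod p)
  set b : ZMod p := ((Φ i).const : ZMod p)
  constructor
  · intro h
    have : v 0 = -(b * a⁻¹) := by
      have h1 : a * v 0 = -b := eq_neg_of_add_eq_zero_left h
      calc v 0 = a⁻¹ * (a * v 0) := by rw [← mul_assoc, inv_mul_cancel₀ ha, one_mul]
        _ = -(b * a⁻¹) := by rw [h1]; ring
    exact this
  · intro h
    rw [h]
    calc a * -(b * a⁻¹) + b = -(a * a⁻¹) * b + b := by ring
      _ = 0 := by rw [mul_inv_cancel₀ ha]; ring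

/-- Two forms (with `p ∤ aᵢ, aⱼ`) have the same root mod `p` iff `p ∣ Dᵢⱼ`.
[cite: GreenTao2010, proof of Lemma 1.3] -/
theorem root_eq_root_iff (Φ : Fin t → AffLinForm 1) {i j : Fin t}
    (hai : (((Φ i).coeff 0 : ℤ) : ZMod p) ≠ 0) (haj : (((Φ j).coeff 0 : ℤ) : ZMod p) ≠ 0) :
    root Φ p i = root Φ p j ↔ (p : ℤ) ∣ disc Φ i j := by
  rw [← ZMod.intCast_zmod_eq_zero_iff_dvd, disc]
  push_cast
  set a : ZMod p := (((Φ i).coeff 0 : ℤ) : ZMod p)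
  set b : ZMod p := ((Φ i).const : ZMod p)
  set a' : ZMod p := (((Φ j).coeff 0 : ℤ) : ZMod p)
  set b' : ZMod p := ((Φ j).const : ZMod p)
  simp only [root]
  have e1 : a * a⁻¹ = 1 := mul_inv_cancel₀ hai
  have e2 : a' * a'⁻¹ = 1 := mul_inv_cancel₀ haj
  constructor
  · intro h
    have h2 : b * a⁻¹ = b' * a'⁻¹ := neg_injective h
    linear_combination (-(a * a')) * h2 + (a' * b) * e1 - (a * b') * e2
  · intro h
    have h2 : a * b' = a' * b := sub_eq_zero.mp h
    have h3 : b * a⁻¹ = b' * a'⁻¹ := by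
      linear_combination (-(a⁻¹ * a'⁻¹)) * h2 + (b' * a'⁻¹) * e1 - (b * a⁻¹) * e2
    rw [h3]

/-! ### The local factor in terms of the number of roots -/

/-- `#{n ∈ ℤ/p : p ∤ φ₁(n) ⋯ φ_t(n)} = p - ν`. [cite: GreenTao2010, proof of Lemma 1.3] -/
theorem goodCount_dimOne (Φ : Fin t → AffLinForm 1) (ha : ∀ i, (((Φ i).coeff 0 : ℤ) : ZMod p) ≠ 0) :
    goodCount Φ p = p - rootCount Φ p := by
  classical
  unfold goodCount rootCount
  -- `{v : ∀ i, φᵢ(v) ≠ 0}` corresponds to the complement of the set of roots under `v ↦ v 0`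
  have h1 : (({v : Fin 1 → ZMod p | ∀ i, ¬ (Φ i).modEval p v = 0} : Finset _)) =
      ((univ : Finset (ZMod p)) \ (univ : Finset (Fin t)).image (root Φ p)).map
        ⟨fun x : ZMod p => (fun _ : Fin 1 => x), fun x y hxy => congr_fun hxy 0⟩ := by
    ext v
    simp only [Finset.mem_filter, Finset.mem_univ, true_and, Finset.mem_map, Finset.mem_sdiff,
      Finset.mem_image, not_exists, Function.Embedding.coeFn_mk]
    constructor
    · intro hv
      refine ⟨v 0, fun i hi => hv i ((modEval_eq_zero_iff Φ (ha i) v).mpr hi.symm), ?_⟩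
      funext k
      rw [Fin.fin_one_eq_zero k]
    · rintro ⟨x, hx, rfl⟩ i hi
      exact hx i ((modEval_eq_zero_iff Φ (ha i) _).mp hi).symm
  rw [h1, Finset.card_map, Finset.card_sdiff_of_subset (Finset.subset_univ _), Finset.card_univ,
    ZMod.card]

/-- `ν ≤ t`. [folklore] -/
theorem rootCount_le (Φ : Fin t → AffLinForm 1) (p : ℕ) : rootCount Φ p ≤ t := by
  unfold rootCount
  exact Finset.card_image_le.trans (by simp)

/-- `1 ≤ ν` when `t ≥ 1`. [folklore] -/
theorem one_le_rootCount (Φ : Fin t → AffLinForm 1) (p : ℕ) (ht : 1 ≤ t) : 1 ≤ rootCount Φ p := by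
  unfold rootCount
  refine Finset.card_pos.mpr ⟨root Φ p ⟨0, ht⟩, Finset.mem_image_of_mem _ (Finset.mem_univ _)⟩

/-- `ν ≤ p`. [folklore] -/
theorem rootCount_le_prime (Φ : Fin t → AffLinForm 1) : rootCount Φ p ≤ p := by
  unfold rootCount
  exact (Finset.card_le_univ _).trans (by rw [ZMod.card])

/-- **`β_p = (p/(p-1))^t (p - ν)/p`** for a `d = 1` system and a prime `p ∤ a₁ ⋯ a_t`.
[cite: GreenTao2010, proof of Lemma 1.3] -/
theorem localFactor_dimOne (Φ : Fin t → AffLinForm 1) (ha : ∀ i, (((Φ i).coeff 0 : ℤ) : ZMod p) ≠ 0) :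
    localFactor Φ p = ((p : ℝ) / (p - 1)) ^ t * (((p : ℝ) - rootCount Φ p) / p) := by
  rw [localFactor_prime, goodCount_dimOne Φ ha, Nat.cast_sub (rootCount_le_prime Φ), pow_one]
  ring

/-! ### Bounds -/

omit hp in
/-- `(p/(p-1))^t (1 - t/p) ≤ 1` (Bernoulli). [folklore] -/
theorem div_pred_pow_mul_le_one {p : ℕ} (hp2 : 2 ≤ p) (t : ℕ) :
    ((p : ℝ) / (p - 1)) ^ t * (((p : ℝ) - t) / p) ≤ 1 := by
  have hp0 : (0 : ℝ) < p := by exact_mod_cast (by omega : 0 < p)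
  have hp1 : (0 : ℝ) < (p : ℝ) - 1 := by
    have : (2 : ℝ) ≤ p := by exact_mod_cast hp2
    linarith
  -- `1 - t/p ≤ (1 - 1/p)^t`
  have hB : 1 + (t : ℝ) * (-(1 / (p : ℝ))) ≤ (1 + -(1 / (p : ℝ))) ^ t := by
    refine one_add_mul_le_pow ?_ t
    have : (1 : ℝ) / p ≤ 1 := by rw [div_le_one hp0]; exact_mod_cast (by omega : 1 ≤ p)
    linarith
  have h1 : ((p : ℝ) - t) / p = 1 + (t : ℝ) * (-(1 / (p : ℝ))) := by field_simp; ring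
  have h2 : ((p : ℝ) / (p - 1)) = (1 + -(1 / (p : ℝ)))⁻¹ := by
    rw [show (1 : ℝ) + -(1 / (p : ℝ)) = ((p : ℝ) - 1) / p by field_simp; ring, inv_div]
  have h3 : 0 < (1 + -(1 / (p : ℝ))) ^ t := by
    apply pow_pos
    have : (1 : ℝ) / p < 1 := by rw [div_lt_one hp0]; exact_mod_cast (by omega : 1 < p)
    linarith
  rw [h1, h2, inv_pow, inv_mul_le_iff₀ h3, mul_one]
  exact hB

/-- `β_p > 0` for `p > t` (and `p ∤ aᵢ`). [folklore] -/
theorem localFactor_dimOne_pos (Φ : Fin t → AffLinForm 1) (ha : ∀ i, (((Φ i).coeff 0 : ℤ) : ZMod p) ≠ 0)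
    (hpt : t < p) : 0 < localFactor Φ p := by
  have hp1 : (1 : ℝ) < p := by exact_mod_cast hp.out.one_lt
  have hν : (rootCount Φ p : ℝ) < p := by exact_mod_cast (rootCount_le Φ p).trans_lt hpt
  rw [localFactor_dimOne Φ ha]
  refine mul_pos (pow_pos (div_pos (by linarith) (by linarith)) t) (div_pos (by linarith) (by linarith))

/-- Lower bound `β_p ≥ (p/(p-1))^t (p - t)/p`. [folklore] -/
theorem localFactor_dimOne_ge (Φ : Fin t → AffLinForm 1) (ha : ∀ i, (((Φ i).coeff 0 : ℤ) : ZMod p) ≠ 0) :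
    ((p : ℝ) / (p - 1)) ^ t * (((p : ℝ) - t) / p) ≤ localFactor Φ p := by
  have hp1 : (1 : ℝ) < p := by exact_mod_cast hp.out.one_lt
  have hν : (rootCount Φ p : ℝ) ≤ t := by exact_mod_cast rootCount_le Φ p
  rw [localFactor_dimOne Φ ha]
  refine mul_le_mul_of_nonneg_left ?_ (pow_nonneg (div_nonneg (by linarith) (by linarith)) t)
  exact div_le_div_of_nonneg_right (by linarith) (by linarith)

/-- Upper bound `β_p ≤ (p/(p-1))^t (p - 1)/p = (p/(p-1))^{t-1}` for `t ≥ 1` (at least one residue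
is excluded). [folklore] -/
theorem localFactor_dimOne_le_pow_pred (Φ : Fin t → AffLinForm 1)
    (ha : ∀ i, (((Φ i).coeff 0 : ℤ) : ZMod p) ≠ 0) (ht : 1 ≤ t) :
    localFactor Φ p ≤ ((p : ℝ) / (p - 1)) ^ (t - 1) := by
  have hp1 : (1 : ℝ) < p := by exact_mod_cast hp.out.one_lt
  have hp0 : (0 : ℝ) < p := by linarith
  have hν : (1 : ℝ) ≤ rootCount Φ p := by exact_mod_cast one_le_rootCount Φ p ht
  rw [localFactor_dimOne Φ ha]
  calc ((p : ℝ) / (p - 1)) ^ t * (((p : ℝ) - rootCount Φ p) / p)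
      ≤ ((p : ℝ) / (p - 1)) ^ t * (((p : ℝ) - 1) / p) := by
        refine mul_le_mul_of_nonneg_left ?_ (pow_nonneg (div_nonneg hp0.le (by linarith)) t)
        exact div_le_div_of_nonneg_right (by linarith) hp0.le
    _ = ((p : ℝ) / (p - 1)) ^ (t - 1) := by
        obtain ⟨s, rfl⟩ : ∃ s, t = s + 1 := ⟨t - 1, by omega⟩
        have hne : ((p : ℝ) - 1) * p ≠ 0 := mul_ne_zero (by linarith) hp0.ne'
        rw [pow_succ, Nat.add_sub_cancel, mul_assoc, div_mul_div_comm, mul_comm (p : ℝ) ((p : ℝ) - 1),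
          div_self hne, mul_one]

omit hp in
/-- If all roots are distinct then `ν = t`. [folklore] -/
theorem rootCount_eq_of_injective (Φ : Fin t → AffLinForm 1) (h : Function.Injective (root Φ p)) :
    rootCount Φ p = t := by
  unfold rootCount
  rw [Finset.card_image_of_injective _ h, Finset.card_univ, Fintype.card_fin]

/-- **`β_p ≤ 1` when all roots are distinct** (`p ∤ Dᵢⱼ` for all `i ≠ j`): then `ν = t` and
`β_p = (p/(p-1))^t (1 - t/p) ≤ 1`. [cite: GreenTao2010, proof of Lemma 1.3] -/
theorem localFactor_dimOne_le_one (Φ : Fin t → AffLinForm 1)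
    (ha : ∀ i, (((Φ i).coeff 0 : ℤ) : ZMod p) ≠ 0)
    (hD : ∀ i j, i ≠ j → ¬ (p : ℤ) ∣ disc Φ i j) : localFactor Φ p ≤ 1 := by
  have hinj : Function.Injective (root Φ p) := fun i j hij => by
    by_contra hne
    exact hD i j hne ((root_eq_root_iff Φ (ha i) (ha j)).mp hij)
  rw [localFactor_dimOne Φ ha, rootCount_eq_of_injective Φ hinj]
  exact div_pred_pow_mul_le_one hp.out.two_le t

/-! ### Monotonicity in the coincidence pattern -/

/-- If every coincidence of roots of `Φ` is a coincidence of roots of `Φ'`, then `Φ'` has at most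
as many distinct roots as `Φ`. [folklore] -/
theorem rootCount_le_of_coincidences (Φ Φ' : Fin t → AffLinForm 1)
    (h : ∀ i j, root Φ p i = root Φ p j → root Φ' p i = root Φ' p j) :
    rootCount Φ' p ≤ rootCount Φ p := by
  classical
  unfold rootCount
  -- the map `rᵢ ↦ r'ᵢ` is well defined on the image and surjective onto the image
  let g : ZMod p → ZMod p := fun x =>
    if hx : ∃ i, root Φ p i = x then root Φ' p hx.choose else 0
  have hg : ∀ i, g (root Φ p i) = root Φ' p i := by
    intro i
    have hx : ∃ i', root Φ p i' = root Φ p i := ⟨i, rfl⟩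
    simp only [g, dif_pos hx]
    exact h _ _ hx.choose_spec
  have himage : (univ : Finset (Fin t)).image (root Φ' p) =
      ((univ : Finset (Fin t)).image (root Φ p)).image g := by
    rw [Finset.image_image]
    exact Finset.image_congr fun i _ => (hg i).symm
  rw [himage]
  exact Finset.card_image_le

/-- **Monotonicity of `β_p` in the coincidence pattern**: for two `d = 1` systems of `t` forms with
`p ∤ aᵢ, a'ᵢ`, if `p ∣ Dᵢⱼ(Φ) ⟹ p ∣ Dᵢⱼ(Φ')` for all `i, j`, then `β_p(Φ) ≤ β_p(Φ')` (fewer distinct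
roots exclude fewer residues). [cite: GreenTao2010, proof of Lemma 1.3] -/
theorem localFactor_dimOne_mono (Φ Φ' : Fin t → AffLinForm 1)
    (ha : ∀ i, (((Φ i).coeff 0 : ℤ) : ZMod p) ≠ 0) (ha' : ∀ i, (((Φ' i).coeff 0 : ℤ) : ZMod p) ≠ 0)
    (h : ∀ i j, (p : ℤ) ∣ disc Φ i j → (p : ℤ) ∣ disc Φ' i j) :
    localFactor Φ p ≤ localFactor Φ' p := by
  have hp1 : (1 : ℝ) < p := by exact_mod_cast hp.out.one_lt
  have hp0 : (0 : ℝ) < p := by linarith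
  have hν : (rootCount Φ' p : ℝ) ≤ rootCount Φ p := by
    exact_mod_cast rootCount_le_of_coincidences Φ Φ' fun i j hij =>
      (root_eq_root_iff Φ' (ha' i) (ha' j)).mpr (h i j ((root_eq_root_iff Φ (ha i) (ha j)).mp hij))
  rw [localFactor_dimOne Φ ha, localFactor_dimOne Φ' ha']
  refine mul_le_mul_of_nonneg_left ?_ (pow_nonneg (div_nonneg hp0.le (by linarith)) t)
  exact div_le_div_of_nonneg_right (by linarith) hp0.le

end Prime

end Summit.Parity.GeneralizedHardyLittlewood.Theorems
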